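import Summits.RiemannHypothesis.RiemannHypothesis.Theorems.HandoffDodgerCleanHorizon
import HarnessLib

/-!
# HANDOFF — the CLEAN HORIZON as the input of the potential bound: `N ≤ Λ_K` on `[0, T′]` and `N − Λ_K ≤ −D` with `D ≈ (deficit − s − 1)⁺` (rh-explicit, track «HANDOFF», seat prove-2 gen9, ATTEMPT-18 (D-4) horizon glue)

HONEST FRAMING. Nothing here bears on the truth of RH; this is zero COUNTING. The unified cost bound of ATTEMPT-18 (D-4)
(`HandoffDodgerPotential.prod_killed_le_prod_lattice_mul_exp`) needs, for the killing height `T′` with `K := N(T′)` and the lattice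
counting function `Λ_K(t) = min(⌊bt/π⌋, K)`: (i) `πK/b ≤ T′`, (ii) `N(t) − Λ_K(t) ≤ −D(t)` on `[0, T′]` for a continuous `D ≥ 0`, and then a lower
bound for `∫_0^{T′} t·D(t)dt`. THIS FILE derives (i)–(ii) from the tree's clean-horizon lemma `zetaZeroCount_lattice_le` (ATTEMPT-16 Lemma B1 (a):
`N(πk/b) ≤ k − 1` for lattice points below the undershot horizon `T*`) when the killing height is itself a lattice point `T′ = πk′/b ≤ T*`:

* `latticeTop_le` — `K ≤ k′ − 1`, hence `πK/b ≤ T′ − π/b`;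
* **`count_le_latticeCount`** — `N(t) ≤ min(⌊bt/π⌋, K)` for all `t ∈ [0, T′]`;
* **`count_sub_latticeCount_le`** — for `t ∈ [0, T′]` with `t < πK/b`: `N(t) − Λ_K(t) ≤ −((T₀/2π)·negMulLog(t/T₀) − s − 1)`
  (`(T₀/2π)negMulLog(t/T₀) = (t/2π)log(T₀/t)` is the deficit; needs `s ≥ 1` below `t = 14`);
* **`count_sub_latticeCount_le_neg_taper`** — with the continuous, non-negative
  `D(t) = max(0, (T₀/2π)negMulLog(t/T₀) − s − 1)·max(0, min(1, πK/b − t))` (the deficit gain, tapered off linearly on `[πK/b − 1, πK/b]`):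
  `N(t) − Λ_K(t) ≤ −D(t)` on `[0, T′]`, `D` continuous, `D ≥ 0` — exactly the hypotheses `hD`, `hD0`, `hΔ` of `HandoffDodgerPotential`.
No `sorry`, standard axioms, no definitions (`D` is written out).

References: this track (ATTEMPT-16 §3 Lemma B1; ATTEMPT-18 §1 (D-2), (D-4)).
-/

set_option linter.dupNamespace false

noncomputable section

open Real Set

namespace Summit.RiemannHypothesis.RiemannHypothesis.Theorems.Handoff

open Literature.NumberTheory.LFunctions

/-! ## The killing height is a lattice point below the undershot horizon -/

section

variable {b T₀ s Tstar : ℝ} {k' : ℕ}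

/-- With `T′ = πk′/b ≤ T*` (`k′ ≥ 1`) and `K := N(T′)`: `K ≤ k′ − 1`. [this track, ATTEMPT-18 (D-4)] -/
theorem latticeTop_le (hb : 1 ≤ b) (hT₀ : T₀ = 2 * π * Real.exp (1 + 2 * b)) (hs0 : 0 ≤ s)
    (hs : ∀ t : ℝ, 14 ≤ t → t ≤ T₀ → (zetaZeroCount t : ℝ) ≤ t / (2 * π) * Real.log (t / (2 * π * Real.exp 1)) + s)
    (hT1 : Tstar ≤ T₀ - 4 * π * (s + 2)) (hT2 : T₀ ≤ 11 / 10 * Tstar) (hQ1b : s + 1 ≤ 14 / (2 * π) * Real.log (T₀ / 14))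
    (hk' : 1 ≤ k') (hk'T : π * k' / b ≤ Tstar) :
    zetaZeroCount (π * k' / b) + 1 ≤ k' := by
  have h := zetaZeroCount_lattice_le hb hT₀ hs0 hs hT1 hT2 hQ1b hk' hk'T
  have h' : (zetaZeroCount (π * k' / b) : ℝ) + 1 ≤ k' := by linarith
  exact_mod_cast h'

/-- **`N(t) ≤ min(⌊bt/π⌋, K)` on `[0, T′]`** (`T′ = πk′/b ≤ T*`, `K = N(T′)`): on `[ℓ_j, ℓ_{j+1})` the lattice count is `j` and
`N(t) ≤ N(ℓ_{j+1}) ≤ j` by the clean horizon; and `N(t) ≤ N(T′) = K`. [this track, ATTEMPT-18 (D-4)] -/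
theorem count_le_latticeCount (hb : 1 ≤ b) (hT₀ : T₀ = 2 * π * Real.exp (1 + 2 * b)) (hs0 : 0 ≤ s)
    (hs : ∀ t : ℝ, 14 ≤ t → t ≤ T₀ → (zetaZeroCount t : ℝ) ≤ t / (2 * π) * Real.log (t / (2 * π * Real.exp 1)) + s)
    (hT1 : Tstar ≤ T₀ - 4 * π * (s + 2)) (hT2 : T₀ ≤ 11 / 10 * Tstar) (hQ1b : s + 1 ≤ 14 / (2 * π) * Real.log (T₀ / 14))
    (hk'T : π * k' / b ≤ Tstar) {t : ℝ} (ht0 : 0 ≤ t) (ht : t ≤ π * k' / b) :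
    (zetaZeroCount t : ℝ) ≤ ((min ⌊b * t / π⌋₊ (zetaZeroCount (π * k' / b)) : ℕ) : ℝ) := by
  have hb0 : 0 < b := by linarith
  have hπ := Real.pi_pos
  norm_cast
  refine le_min ?_ (zetaZeroCount_mono ht)
  -- `N(t) ≤ ⌊bt/π⌋`: let `j := ⌊bt/π⌋ + 1`; then `t < πj/b`, and either `j ≤ k′` (clean horizon at `j`) or not (impossible: `t ≤ T′`)
  set j : ℕ := ⌊b * t / π⌋₊ + 1 with hj
  have hbt : 0 ≤ b * t / π := by positivity
  have htj : t < π * j / b := by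
    have h1 : b * t / π < j := by rw [hj]; push_cast; exact Nat.lt_floor_add_one _
    rw [lt_div_iff₀ hb0]; rw [div_lt_iff₀ hπ] at h1; linarith
  rcases le_or_gt j k' with hjk | hjk
  · -- clean horizon at the lattice point `πj/b ≤ T′ ≤ T*`
    have hjT : π * j / b ≤ Tstar := by
      refine le_trans ?_ hk'T
      exact div_le_div_of_nonneg_right (mul_le_mul_of_nonneg_left (by exact_mod_cast hjk) hπ.le) hb0.le
    have h1 := zetaZeroCount_lattice_le hb hT₀ hs0 hs hT1 hT2 hQ1b (by omega : 1 ≤ j) hjT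
    have h2 : zetaZeroCount t ≤ zetaZeroCount (π * j / b) := zetaZeroCount_mono htj.le
    have h3 : (zetaZeroCount t : ℝ) ≤ j - 1 := le_trans (by exact_mod_cast h2) h1
    have h4 : ((j : ℕ) : ℝ) - 1 = ((⌊b * t / π⌋₊ : ℕ) : ℝ) := by rw [hj]; push_cast; ring
    rw [h4] at h3
    exact_mod_cast h3
  · -- `j > k′` means `⌊bt/π⌋ ≥ k′`, i.e. `t ≥ πk′/b = T′`, so `t = T′` and `N(T′) ≤ k′ − 1 ≤ ⌊bt/π⌋`... but then `⌊bt/π⌋ ≥ k′ > N(T′)`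
    have hk'le : k' ≤ ⌊b * t / π⌋₊ := by rw [hj] at hjk; omega
    rcases Nat.eq_zero_or_pos k' with hk0 | hk0
    · -- `k′ = 0`: `t ≤ 0`, so `t = 0` and `N(0) = 0`
      have : t ≤ 0 := by simpa [hk0] using ht
      have ht00 : t = 0 := le_antisymm this ht0
      rw [ht00, zetaZeroCount_eq_zero_of_nonpos le_rfl]
      exact Nat.zero_le _
    · have h1 := latticeTop_le hb hT₀ hs0 hs hT1 hT2 hQ1b hk0 hk'T
      have h2 : zetaZeroCount t ≤ zetaZeroCount (π * k' / b) := zetaZeroCount_mono ht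
      omega

/-- The deficit in `negMulLog` form equals `(t/2π)log(T₀/t)` for `t > 0`, and `bt/π = (t/2π)log(t/(2πe)) + deficit`.
(Re-export of the tree's `deficit_eq_negMulLog`, `main_eq_lattice_sub_deficit`.) -/
theorem lattice_eq_main_add_deficit (hT₀ : T₀ = 2 * π * Real.exp (1 + 2 * b)) {t : ℝ} (ht : 0 < t) :
    b * t / π = t / (2 * π) * Real.log (t / (2 * π * Real.exp 1)) + T₀ / (2 * π) * negMulLog (t / T₀) := by
  have hT₀pos : 0 < T₀ := by rw [hT₀]; positivity
  rw [← deficit_eq_negMulLog hT₀pos ht, main_eq_lattice_sub_deficit (b := b) ht, ← hT₀]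
  ring

/-- **The deficit gain below the top lattice point**: for `t ∈ [0, T′]` with `⌊bt/π⌋ < K` (i.e. `t < πK/b`) and `s ≥ 1`:
`N(t) − Λ_K(t) ≤ −((T₀/2π)·negMulLog(t/T₀) − s − 1)` (for `t ≥ 14` from the count bound, for `t < 14` from `N = 0` and
`(t/2π)log(t/2πe) ≥ −1`). [this track, ATTEMPT-18 (D-4)] -/
theorem count_sub_latticeCount_le (hb : 1 ≤ b) (hT₀ : T₀ = 2 * π * Real.exp (1 + 2 * b)) (hs1 : 1 ≤ s)
    (hs : ∀ t : ℝ, 14 ≤ t → t ≤ T₀ → (zetaZeroCount t : ℝ) ≤ t / (2 * π) * Real.log (t / (2 * π * Real.exp 1)) + s)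
    {K : ℕ} {t : ℝ} (ht0 : 0 ≤ t) (htT₀ : t ≤ T₀) (htK : ⌊b * t / π⌋₊ < K) :
    (zetaZeroCount t : ℝ) - ((min ⌊b * t / π⌋₊ K : ℕ) : ℝ) ≤ -(T₀ / (2 * π) * negMulLog (t / T₀) - s - 1) := by
  have hb0 : 0 < b := by linarith
  have hT₀pos : 0 < T₀ := by rw [hT₀]; positivity
  rw [min_eq_left htK.le]
  -- `⌊bt/π⌋ ≥ bt/π − 1`
  have hfloor : b * t / π - 1 ≤ ((⌊b * t / π⌋₊ : ℕ) : ℝ) := by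
    have := Nat.lt_floor_add_one (b * t / π)
    linarith
  rcases eq_or_lt_of_le ht0 with ht00 | htpos
  · -- `t = 0`
    rw [← ht00]
    simp [zetaZeroCount_eq_zero_of_nonpos le_rfl, negMulLog]
    linarith
  have hmain := lattice_eq_main_add_deficit (b := b) hT₀ htpos
  rcases lt_or_ge t 14 with hlt | hge
  · -- below the first zero: `N(t) = 0`, and `(t/2π)log(t/2πe) ≥ −1`
    have hN0 : (zetaZeroCount t : ℝ) = 0 := by
      have h0 := zetaZeroCount_mono hlt.le
      rw [zetaZeroCount_fourteen] at h0
      exact_mod_cast Nat.le_zero.1 h0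
    -- `x log(x/e) ≥ −1` with `x = t/(2π)`:  `(t/2π)log(t/(2πe)) = (t/2π)(log(t/2π) − 1) ≥ −1`
    have hsm : -1 ≤ t / (2 * π) * Real.log (t / (2 * π * Real.exp 1)) := by
      have hx : 0 < t / (2 * π) := by positivity
      have e : Real.log (t / (2 * π * Real.exp 1)) = Real.log (t / (2 * π)) - 1 := by
        rw [show t / (2 * π * Real.exp 1) = t / (2 * π) / Real.exp 1 by ring, Real.log_div hx.ne' (Real.exp_pos 1).ne',
          Real.log_exp]
      rw [e]
      -- `x(log x − 1) ≥ −1` ⟸ `log x ≥ 1 − 1/x`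
      have h1 := Real.one_sub_inv_le_log_of_pos hx
      have h2 : t / (2 * π) * (Real.log (t / (2 * π)) - 1) ≥ t / (2 * π) * (1 - (t / (2 * π))⁻¹ - 1) :=
        mul_le_mul_of_nonneg_left (by linarith) hx.le
      have h3 : t / (2 * π) * (1 - (t / (2 * π))⁻¹ - 1) = -1 := by field_simp; ring
      linarith
    rw [hN0]
    linarith
  · have hN := hs t hge htT₀
    linarith

end

/-! ## The tapered deficit `D` -/

/-- **The hypotheses of the potential bound, discharged.** Let `T′ = πk′/b ≤ T*` be a lattice point below the undershot horizon (clean-horizon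
hypotheses as in `zetaZeroCount_lattice_le`, and `s ≥ 1`), `K := N(T′)`, and
`D(t) := max(0, (T₀/2π)negMulLog(t/T₀) − s − 1)·max(0, min(1, πK/b − t))`. Then `πK/b ≤ T′`, `D` is continuous, `D ≥ 0`, and
`N(t) − min(⌊bt/π⌋, K) ≤ −D(t)` for every `t ∈ [0, T′]`. [this track, ATTEMPT-18 (D-4)] -/
theorem count_sub_latticeCount_le_neg_taper {b T₀ s Tstar : ℝ} {k' : ℕ} (hb : 1 ≤ b) (hT₀ : T₀ = 2 * π * Real.exp (1 + 2 * b))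
    (hs1 : 1 ≤ s)
    (hs : ∀ t : ℝ, 14 ≤ t → t ≤ T₀ → (zetaZeroCount t : ℝ) ≤ t / (2 * π) * Real.log (t / (2 * π * Real.exp 1)) + s)
    (hT1 : Tstar ≤ T₀ - 4 * π * (s + 2)) (hT2 : T₀ ≤ 11 / 10 * Tstar) (hQ1b : s + 1 ≤ 14 / (2 * π) * Real.log (T₀ / 14))
    (hk'T : π * k' / b ≤ Tstar) :
    π * (zetaZeroCount (π * k' / b)) / b ≤ π * k' / b ∧
    Continuous (fun t : ℝ => max 0 (T₀ / (2 * π) * negMulLog (t / T₀) - s - 1) *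
      max 0 (min 1 (π * (zetaZeroCount (π * k' / b)) / b - t))) ∧
    (∀ t : ℝ, 0 ≤ max 0 (T₀ / (2 * π) * negMulLog (t / T₀) - s - 1) * max 0 (min 1 (π * (zetaZeroCount (π * k' / b)) / b - t))) ∧
    ∀ t ∈ Icc 0 (π * k' / b), (zetaZeroCount t : ℝ) - ((min ⌊b * t / π⌋₊ (zetaZeroCount (π * k' / b)) : ℕ) : ℝ) ≤
      -(max 0 (T₀ / (2 * π) * negMulLog (t / T₀) - s - 1) * max 0 (min 1 (π * (zetaZeroCount (π * k' / b)) / b - t))) := by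
  have hb0 : 0 < b := by linarith
  have hπ := Real.pi_pos
  have hs0 : 0 ≤ s := by linarith
  have hT₀pos : 0 < T₀ := by rw [hT₀]; positivity
  have hTstar_le : Tstar ≤ T₀ := by nlinarith
  set K : ℕ := zetaZeroCount (π * k' / b) with hK
  refine ⟨?_, ?_, fun t => mul_nonneg (le_max_left _ _) (le_max_left _ _), fun t ht => ?_⟩
  · -- `πK/b ≤ T′`
    rcases Nat.eq_zero_or_pos k' with hk0 | hk0
    · have : K = 0 := by
        rw [hK, hk0]; simp [zetaZeroCount_eq_zero_of_nonpos]
      rw [this, hk0]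
    · have h1 := latticeTop_le hb hT₀ hs0 hs hT1 hT2 hQ1b hk0 hk'T
      have : (K : ℝ) ≤ k' := by rw [hK]; exact_mod_cast (by omega : zetaZeroCount (π * k' / b) ≤ k')
      exact div_le_div_of_nonneg_right (mul_le_mul_of_nonneg_left this hπ.le) hb0.le
  · -- continuity
    refine Continuous.mul (continuous_const.max ?_) (continuous_const.max (continuous_const.min (by fun_prop)))
    exact ((continuous_const.mul (continuous_negMulLog.comp (continuous_id.div_const _))).sub continuous_const).sub
      continuous_const
  · -- the inequality
    have hle := count_le_latticeCount hb hT₀ hs0 hs hT1 hT2 hQ1b hk'T ht.1 ht.2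
    rcases lt_or_ge t (π * K / b) with htK | htK
    · -- below the top lattice point: taper ≤ 1, deficit gain available
      have hfl : ⌊b * t / π⌋₊ < K := by
        have hbt : 0 ≤ b * t / π := by have := ht.1; positivity
        rw [Nat.floor_lt hbt]
        rw [lt_div_iff₀ hb0] at htK
        rw [div_lt_iff₀ hπ]
        linarith
      have h1 := count_sub_latticeCount_le (K := K) hb hT₀ hs1 hs ht.1 (ht.2.trans (hk'T.trans hTstar_le)) hfl
      have htaper : max 0 (min 1 (π * (K : ℝ) / b - t)) ≤ 1 := max_le zero_le_one (min_le_left _ _)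
      have htaper0 : 0 ≤ max 0 (min 1 (π * (K : ℝ) / b - t)) := le_max_left _ _
      -- `N − Λ ≤ min(0, −(g)) ≤ −max(0,g)·taper`
      have h2 : (zetaZeroCount t : ℝ) - ((min ⌊b * t / π⌋₊ K : ℕ) : ℝ) ≤ 0 := by linarith
      set g : ℝ := T₀ / (2 * π) * negMulLog (t / T₀) - s - 1 with hg
      rcases le_or_gt g 0 with hg0 | hg0
      · rw [max_eq_left hg0, zero_mul, neg_zero]; exact h2
      · rw [max_eq_right hg0.le]
        have : g * max 0 (min 1 (π * (K : ℝ) / b - t)) ≤ g := by nlinarith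
        linarith
    · -- at or above the top lattice point: the taper vanishes
      have htaper : max 0 (min 1 (π * (K : ℝ) / b - t)) = 0 :=
        max_eq_left ((min_le_right _ _).trans (by linarith))
      rw [htaper, mul_zero, neg_zero]
      linarith

end Summit.RiemannHypothesis.RiemannHypothesis.Theorems.Handoff

end
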